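import Literature.Topology.PlanarFoliations.StarPunctures
import Literature.Topology.PlanarFoliations.OrderIsoExtend
import Literature.Topology.FourManifolds.TautFoliationsFenceTrans
import Literature.Topology.FourManifolds.TautFoliationsPlaqueSlide
import HarnessLib

/-!
# The gate fence of a prong star: passing a corner in the ambient foliation

Topic: Topology / PlanarFoliations, sequel to `StarPunctures.lean`; fences
(`TautFoliationsFences.lean`, `TautFoliationsFenceTrans.lean`, `TautFoliationsPlaqueSlide.lean`).
Let `D` be star data, `v` a saddle puncture with prong star `P`, and `j`, `j'` two sectors. In
the ambient foliated manifold `(M, T)` the whole star is mapped by `g` into the flow box `box v`,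
at heights `Λ (H z)` (`levelIso`, the level as an order isomorphism of the height). Given a
**level conversion** `χ : ℝ ≃o ℝ` with `χ τ₀ = 0` (levels ↦ heights of the star), the **gate
fence** from the star vertical of the sector `j` at parameter `β₀` to the star vertical of the
sector `j'` at `β₀`, at level `τ`, runs `g ∘ (horizontal of S j at height χ τ from b = β₀ to the
axis)`, then slides inside the plaque of `box v` at height `Λ (χ τ)` from `g (pt j (0, χ τ))` to
`g (pt j' (0, χ τ))`, then runs `g ∘ (horizontal of S j' from the axis to b = β₀)`. It is a fence
of `T` (with the single local datum `box v`, `ψ = Λ ∘ χ`) over the concatenated germ path, from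
`g (pt j (β₀, 0))` through `g v` to `g (pt j' (β₀, 0))` (`isFenceOn_gateFence`). On the side of
the levels where the planar leaves pass from `S j` to `S j'` (`j' = nb j h`) the middle slide is
constant and the horizontal is the image of one planar leaf — the tracked leaf around the corner
(`Literature/Topology/PlanarFoliations/ProngStarEnds.lean`).

* `StarData.levelIso` (**definition**, `Λ` extended to `ℝ ≃o ℝ`), `level_eq_levelIso` (**proved**);
* `StarData.gateIso` (**definition**: `Λ ∘ χ`), `StarData.βline`, `StarData.sectorFence`,
  `StarData.sectorGerm`, `StarData.sectorPath` (**definitions**), `StarData.isFenceOn_sectorFence`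
  (**proved**);
* `StarData.gateT₁`, `StarData.gateT₂`, `StarData.gateFence`, `StarData.gatePath` (**definitions**),
  `StarData.isFenceOn_gateFence`, `StarData.gateFence_zero`, `StarData.gateFence_one` (**proved**).

## References

* C. Camacho, A. Lins Neto, *Geometric Theory of Foliations*, Birkhäuser (1985), Ch. VII §2
  [CamachoLinsNeto1985].
-/

noncomputable section

open Set Filter Function Metric unitInterval
open _root_.Topology
open Literature.Topology.FourManifolds Literature.Topology.FourManifolds.Foliation

namespace Literature.Topology.PlanarFoliations

variable {X : Type*} [TopologicalSpace X] {F : Foliation ℝ X} {ι : X → ℂ}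
variable {B : Type*} [NormedAddCommGroup B] {M : Type*} [TopologicalSpace M]
  {T : Foliation B M} {g : ℂ → M}

namespace StarData

variable (D : StarData F ι T g) {v : ℂ} (h : D.nprong v ≠ 0)

/-! ## The level as an order isomorphism of the height -/

/-- **The level as an order isomorphism of `ℝ`** extending `Λ_v` from `[-ρ, ρ]`. [folklore] -/
def levelIso : ℝ ≃o ℝ :=
  orderIsoExtend (D.levelH h) (-(D.star v h).ρ) (D.star v h).ρ (by linarith [(D.star v h).ρ_pos])
    (D.continuousOn_levelH h) (D.strictMonoOn_levelH h)

/-- On `[-ρ, ρ]` the order isomorphism is `Λ_v`. [folklore] -/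
theorem levelIso_apply_of_mem {s : ℝ} (hs : s ∈ Icc (-(D.star v h).ρ) (D.star v h).ρ) :
    D.levelIso h s = D.levelH h s :=
  orderIsoExtend_apply_of_mem _ _ _ hs

/-- **On the sectors, the level is `Λ` of the height.** [folklore] -/
theorem level_eq_levelIso {j : ZMod (D.nprong v)} {z : ℂ} (hz : z ∈ (D.star v h).S j) :
    D.level v z = D.levelIso h ((D.star v h).H z) := by
  rw [D.level_eq_levelH h hz, D.levelIso_apply_of_mem h]
  exact ((ProngStar.mem_rect_iff _).1 ((D.star v h).chart_mem_rect hz)).2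

/-- The level of a point of the star with coordinates in the half square. [folklore] -/
theorem level_pt_eq_levelIso (j : ZMod (D.nprong v)) {p : ℝ × ℝ} (hp : p ∈ (D.star v h).rect) :
    D.level v ((D.star v h).pt j p) = D.levelIso h p.2 := by
  rw [D.level_eq_levelIso h ((D.star v h).pt_mem hp), (D.star v h).H_pt hp]

/-- `Λ 0 = level v v`. [folklore] -/
theorem levelIso_zero : D.levelIso h 0 = D.level v v := by
  rw [D.levelIso_apply_of_mem h ⟨by linarith [(D.star v h).ρ_pos], (D.star v h).ρ_pos.le⟩, D.levelH_zero h]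

/-! ## The sector fence -/

/-- The conversion from levels to heights of `box v`: `τ ↦ Λ (χ τ)`. [folklore] -/
def gateIso (χ : ℝ ≃o ℝ) : ℝ ≃o ℝ := χ.trans (D.levelIso h)

/-- Unfolding `gateIso`. [folklore] -/
@[simp] theorem gateIso_apply (χ : ℝ ≃o ℝ) (τ : ℝ) : D.gateIso h χ τ = D.levelIso h (χ τ) := rfl

/-- An order isomorphism of `ℝ` is a homeomorphism germ everywhere. [folklore] -/
theorem isHomeoGermAt_orderIso (e : ℝ ≃o ℝ) (t : ℝ) : IsHomeoGermAt e t :=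
  IsHomeoGermAt.of_strictMono e.continuous e.strictMono t

/-- The affine parameter of the sector fence: from `βa` to `βb`. [folklore] -/
def βline (βa βb : ℝ) (θ : I) : ℝ := (1 - (θ : ℝ)) * βa + (θ : ℝ) * βb

/-- `βline βa βb 0 = βa`. [folklore] -/
@[simp] theorem βline_zero (βa βb : ℝ) : βline βa βb 0 = βa := by simp [βline]

/-- `βline βa βb 1 = βb`. [folklore] -/
@[simp] theorem βline_one (βa βb : ℝ) : βline βa βb 1 = βb := by simp [βline]

/-- `βline` is continuous. [folklore] -/
theorem continuous_βline (βa βb : ℝ) : Continuous (βline βa βb) :=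
  ((continuous_const.sub continuous_subtype_val).mul continuous_const).add (continuous_subtype_val.mul continuous_const)

/-- `βline` stays in `[0, ρ]` when its ends do. [folklore] -/
theorem βline_mem {βa βb ρ : ℝ} (ha : βa ∈ Icc 0 ρ) (hb : βb ∈ Icc 0 ρ) (θ : I) : βline βa βb θ ∈ Icc 0 ρ := by
  have h0 := θ.2.1; have h1 := θ.2.2
  constructor
  · unfold βline; nlinarith [ha.1, hb.1]
  · unfold βline; nlinarith [ha.2, hb.2]

/-- **The sector fence** of the sector `j` from `b = βa` to `b = βb`: at level `τ` the image under
`g` of the horizontal of `S j` at height `χ τ`. [folklore] -/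
def sectorFence (j : ZMod (D.nprong v)) (βa βb : ℝ) (χ : ℝ ≃o ℝ) (θ : I) (τ : ℝ) : M :=
  g ((D.star v h).pt j (βline βa βb θ, χ τ))

/-- The germ path of the sector fence: the germs of `(Λ ∘ χ)⁻¹ ∘ h_{box v}` at the images of the
points of the segment at height `χ τ₀ = 0`. [folklore] -/
def sectorGerm (j : ZMod (D.nprong v)) (βa βb : ℝ) (χ : ℝ ≃o ℝ) (τ₀ : ℝ) (θ : I) : T.GermSpace :=
  T.germSection (D.box_mem v (D.mem_P v h)) (D.gateIso h χ τ₀) (isHomeoGermAt_orderIso (D.gateIso h χ).symm _)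
    ((D.box v (g ((D.star v h).pt j (βline βa βb θ, 0)))).1)

/-- The germ path of the sector fence is continuous. [folklore] -/
theorem continuous_sectorGerm (j : ZMod (D.nprong v)) {βa βb : ℝ} (ha : βa ∈ Icc 0 (D.star v h).ρ)
    (hb : βb ∈ Icc 0 (D.star v h).ρ) (χ : ℝ ≃o ℝ) (τ₀ : ℝ) : Continuous (D.sectorGerm h j βa βb χ τ₀) := by
  refine (T.continuous_germSection (D.box_mem v (D.mem_P v h)) (D.gateIso h χ τ₀)
    (isHomeoGermAt_orderIso (D.gateIso h χ).symm _)).comp ?_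
  have hrect : ∀ θ : I, (βline βa βb θ, (0 : ℝ)) ∈ (D.star v h).rect := fun θ ↦
    (ProngStar.mem_rect_iff _).2 ⟨βline_mem ha hb θ, by simp [(D.star v h).ρ_pos.le]⟩
  have hpt : Continuous fun θ : I ↦ (D.star v h).pt j (βline βa βb θ, 0) :=
    ((D.star v h).continuousOn_pt j).comp_continuous ((continuous_βline βa βb).prodMk continuous_const) hrect
  have hg : Continuous fun θ : I ↦ g ((D.star v h).pt j (βline βa βb θ, 0)) :=
    D.continuousOn.comp_continuous hpt fun θ ↦ D.ball_subset v (D.mem_P v h) (D.mem_ball_of_mem_S h ((D.star v h).pt_mem (hrect θ)))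
  exact continuous_fst.comp ((D.box v).continuousOn.comp_continuous hg fun θ ↦ D.mapsTo_S h j ((D.star v h).pt_mem (hrect θ)))

/-- The germ path of the sector fence, as a path. [folklore] -/
def sectorPath (j : ZMod (D.nprong v)) {βa βb : ℝ} (ha : βa ∈ Icc 0 (D.star v h).ρ) (hb : βb ∈ Icc 0 (D.star v h).ρ)
    (χ : ℝ ≃o ℝ) (τ₀ : ℝ) : Path (D.sectorGerm h j βa βb χ τ₀ 0) (D.sectorGerm h j βa βb χ τ₀ 1) where
  toFun := D.sectorGerm h j βa βb χ τ₀
  continuous_toFun := D.continuous_sectorGerm h j ha hb χ τ₀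
  source' := rfl
  target' := rfl

/-- Values of the sector path. [folklore] -/
@[simp] theorem sectorPath_apply (j : ZMod (D.nprong v)) {βa βb : ℝ} (ha : βa ∈ Icc 0 (D.star v h).ρ)
    (hb : βb ∈ Icc 0 (D.star v h).ρ) (χ : ℝ ≃o ℝ) (τ₀ : ℝ) (θ : I) :
    D.sectorPath h j ha hb χ τ₀ θ = D.sectorGerm h j βa βb χ τ₀ θ := rfl

section SectorFence

variable {j : ZMod (D.nprong v)} {βa βb τ₀ ε : ℝ} {χ : ℝ ≃o ℝ}

/-- Points of the sector fence are points of the sector. [folklore] -/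
theorem pt_mem_of_level (hχ : ∀ τ ∈ Ioo (τ₀ - ε) (τ₀ + ε), χ τ ∈ Icc (-(D.star v h).ρ) (D.star v h).ρ)
    (ha : βa ∈ Icc 0 (D.star v h).ρ) (hb : βb ∈ Icc 0 (D.star v h).ρ) (θ : I) {τ : ℝ} (hτ : τ ∈ Ioo (τ₀ - ε) (τ₀ + ε)) :
    (βline βa βb θ, χ τ) ∈ (D.star v h).rect :=
  (ProngStar.mem_rect_iff _).2 ⟨βline_mem ha hb θ, hχ τ hτ⟩

/-- **The sector fence is a fence** for the sector germ path, with the local datum `box v`,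
`ψ = Λ ∘ χ`. [folklore] -/
theorem isFenceOn_sectorFence (hε : 0 < ε) (hχ₀ : χ τ₀ = 0)
    (hχ : ∀ τ ∈ Ioo (τ₀ - ε) (τ₀ + ε), χ τ ∈ Icc (-(D.star v h).ρ) (D.star v h).ρ)
    (ha : βa ∈ Icc 0 (D.star v h).ρ) (hb : βb ∈ Icc 0 (D.star v h).ρ) :
    IsFenceOn T (D.sectorPath h j ha hb χ τ₀) τ₀ ε (D.sectorFence h j βa βb χ) univ := by
  set P := D.star v h with hP
  have hτ₀ : τ₀ ∈ Ioo (τ₀ - ε) (τ₀ + ε) := ⟨by linarith, by linarith⟩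
  have hbox := D.box_mem v (D.mem_P v h)
  have hrect : ∀ θ : I, ∀ τ ∈ Ioo (τ₀ - ε) (τ₀ + ε), (βline βa βb θ, χ τ) ∈ P.rect := fun θ τ hτ ↦
    D.pt_mem_of_level h hχ ha hb θ hτ
  have hrect0 : ∀ θ : I, (βline βa βb θ, (0 : ℝ)) ∈ P.rect := fun θ ↦ by
    have := hrect θ τ₀ hτ₀; rwa [hχ₀] at this
  -- membership and heights of the fence points
  have hsrc : ∀ θ : I, ∀ τ ∈ Ioo (τ₀ - ε) (τ₀ + ε), D.sectorFence h j βa βb χ θ τ ∈ (D.box v).source := fun θ τ hτ ↦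
    D.mapsTo_S h j (P.pt_mem (hrect θ τ hτ))
  have hheight : ∀ θ : I, ∀ τ ∈ Ioo (τ₀ - ε) (τ₀ + ε),
      height (D.box v) (D.sectorFence h j βa βb χ θ τ) = D.gateIso h χ τ := fun θ τ hτ ↦ by
    rw [height_apply, gateIso_apply]
    exact D.level_pt_eq_levelIso h j (hrect θ τ hτ)
  -- the global local datum
  let Dat : LocalDatum T (D.sectorPath h j ha hb χ τ₀) τ₀ ε (univ ∩ univ) :=
    { box := D.box v
      box_mem := hbox
      φ := (D.gateIso h χ).symm
      ψ := D.gateIso h χ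
      germ_eq := fun θ _ ↦ rfl
      pt_mem := fun θ _ ↦ by
        show plaqueMap (D.box v) (D.gateIso h χ τ₀) _ ∈ _
        exact T.plaqueMap_mem_plaque hbox _ _
      φ_ψ := fun τ _ ↦ (D.gateIso h χ).symm_apply_apply τ
      ψ_φ := Eventually.of_forall fun r ↦ (D.gateIso h χ).apply_symm_apply r
      ψ_cont := (D.gateIso h χ).continuous.continuousOn
      ψ_inj := (D.gateIso h χ).injective.injOn }
  refine ⟨?_, fun θ _ ↦ ?_, fun θ _ ↦ ⟨univ, univ_mem, Dat, fun θ' _ τ hτ ↦ ⟨hsrc θ' τ hτ, hheight θ' τ hτ⟩⟩⟩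
  · -- continuity
    have hc₁ : Continuous fun p : I × ℝ ↦ ((βline βa βb p.1, χ p.2) : ℝ × ℝ) :=
      ((continuous_βline βa βb).comp continuous_fst).prodMk (χ.continuous.comp continuous_snd)
    have hpt : ContinuousOn (fun p : I × ℝ ↦ P.pt j (βline βa βb p.1, χ p.2)) (univ ×ˢ Ioo (τ₀ - ε) (τ₀ + ε)) :=
      (P.continuousOn_pt j).comp hc₁.continuousOn fun p hp ↦ hrect p.1 p.2 hp.2
    exact D.continuousOn.comp hpt fun p hp ↦ D.ball_subset v (D.mem_P v h)
      (D.mem_ball_of_mem_S h (P.pt_mem (hrect p.1 p.2 hp.2)))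
  · -- base
    show g (P.pt j (βline βa βb θ, χ τ₀)) = ofLeafSpace (D.sectorGerm h j βa βb χ τ₀ θ).pt
    have hs := D.mapsTo_S h j (P.pt_mem (hrect0 θ))
    have hl : (D.box v (g (P.pt j (βline βa βb θ, 0)))).2 = D.gateIso h χ τ₀ := by
      rw [gateIso_apply, hχ₀]
      exact D.level_pt_eq_levelIso h j (hrect0 θ)
    rw [hχ₀]
    show g (P.pt j (βline βa βb θ, 0)) = (D.box v).symm ((D.box v (g (P.pt j (βline βa βb θ, 0)))).1, D.gateIso h χ τ₀)
    rw [← hl, Prod.mk.eta, (D.box v).left_inv hs]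

/-- The sector fence at `θ = 0`. [folklore] -/
theorem sectorFence_zero (τ : ℝ) : D.sectorFence h j βa βb χ 0 τ = g ((D.star v h).pt j (βa, χ τ)) := by
  rw [sectorFence, βline_zero]

/-- The sector fence at `θ = 1`. [folklore] -/
theorem sectorFence_one (τ : ℝ) : D.sectorFence h j βa βb χ 1 τ = g ((D.star v h).pt j (βb, χ τ)) := by
  rw [sectorFence, βline_one]

end SectorFence

/-! ## The gate fence -/

section Gate

variable [NormedSpace ℝ B] (j j' : ZMod (D.nprong v)) (β₀ : ℝ) (χ : ℝ ≃o ℝ) (τ₀ : ℝ)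

/-- The axis transversal of the sector `j`, in `M`: `τ ↦ g (pt j (0, χ τ))`. [folklore] -/
def gateT₁ (τ : ℝ) : M := g ((D.star v h).pt j (0, χ τ))

/-- The axis transversal of the sector `j'`, in `M`: `τ ↦ g (pt j' (0, χ τ))`. [folklore] -/
def gateT₂ (τ : ℝ) : M := g ((D.star v h).pt j' (0, χ τ))

/-- **The gate fence**: sector fence of `j` from `β₀` to the axis, slide in `box v` from the axis of
`j` to the axis of `j'`, sector fence of `j'` from the axis to `β₀`. [folklore] -/
def gateFence : I → ℝ → M :=
  transFence (transFence (D.sectorFence h j β₀ 0 χ) (slideFence (D.box v) (D.gateIso h χ) (D.gateT₁ h j χ) (D.gateT₂ h j' χ)))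
    (D.sectorFence h j' 0 β₀ χ)

variable {j j' β₀ χ τ₀}

/-- The middle slide germ path starts where the first sector germ path ends. [folklore] -/
theorem sectorGerm_one_eq_slideGerm_zero (hχ₀ : χ τ₀ = 0) :
    D.sectorGerm h j β₀ 0 χ τ₀ 1 =
      slideGerm (D.box_mem v (D.mem_P v h)) (isHomeoGermAt_orderIso (D.gateIso h χ).symm (D.gateIso h χ τ₀))
        (D.gateT₁ h j χ) (D.gateT₂ h j' χ) 0 := by
  unfold sectorGerm slideGerm
  congr 1
  rw [slideB_zero, βline_one, gateT₁, hχ₀]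

/-- The middle slide germ path ends where the second sector germ path starts. [folklore] -/
theorem slideGerm_one_eq_sectorGerm_zero (hχ₀ : χ τ₀ = 0) :
    slideGerm (D.box_mem v (D.mem_P v h)) (isHomeoGermAt_orderIso (D.gateIso h χ).symm (D.gateIso h χ τ₀))
        (D.gateT₁ h j χ) (D.gateT₂ h j' χ) 1 = D.sectorGerm h j' 0 β₀ χ τ₀ 0 := by
  unfold sectorGerm slideGerm
  congr 1
  rw [slideB_one, βline_zero, gateT₂, hχ₀]

/-- **The gate germ path**, from the germ at `g (pt j (β₀, 0))` to the germ at `g (pt j' (β₀, 0))`.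
[folklore] -/
def gatePath (hχ₀ : χ τ₀ = 0) (hβ₀ : β₀ ∈ Icc 0 (D.star v h).ρ) :
    Path (D.sectorGerm h j β₀ 0 χ τ₀ 0) (D.sectorGerm h j' 0 β₀ χ τ₀ 1) :=
  have h0 : (0 : ℝ) ∈ Icc 0 (D.star v h).ρ := ⟨le_rfl, (D.star v h).ρ_pos.le⟩
  ((D.sectorPath h j hβ₀ h0 χ τ₀).trans
    ((slidePath (D.box_mem v (D.mem_P v h)) (isHomeoGermAt_orderIso (D.gateIso h χ).symm (D.gateIso h χ τ₀))
      (D.gateT₁ h j χ) (D.gateT₂ h j' χ)).cast (D.sectorGerm_one_eq_slideGerm_zero h hχ₀)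
        (D.slideGerm_one_eq_sectorGerm_zero h hχ₀).symm)).trans (D.sectorPath h j' h0 hβ₀ χ τ₀)

/-- **The gate fence is a fence** over the gate germ path, of radius `ε / 4`, when `χ` maps the
level interval of radius `ε` into `[-ρ, ρ]`. [folklore] -/
theorem isFenceOn_gateFence {ε : ℝ} (hε : 0 < ε) (hχ₀ : χ τ₀ = 0)
    (hχ : ∀ τ ∈ Ioo (τ₀ - ε) (τ₀ + ε), χ τ ∈ Icc (-(D.star v h).ρ) (D.star v h).ρ)
    (hβ₀ : β₀ ∈ Icc 0 (D.star v h).ρ) :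
    IsFenceOn T (D.gatePath h hχ₀ hβ₀ (j := j) (j' := j')) τ₀ (ε / 4) (D.gateFence h j j' β₀ χ) univ := by
  set P := D.star v h with hP
  have h0 : (0 : ℝ) ∈ Icc 0 P.ρ := ⟨le_rfl, P.ρ_pos.le⟩
  have hbox := D.box_mem v (D.mem_P v h)
  have hτ₀ : τ₀ ∈ Ioo (τ₀ - ε) (τ₀ + ε) := ⟨by linarith, by linarith⟩
  have hrect : ∀ τ ∈ Ioo (τ₀ - ε) (τ₀ + ε), ((0 : ℝ), χ τ) ∈ P.rect := fun τ hτ ↦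
    (ProngStar.mem_rect_iff _).2 ⟨h0, hχ τ hτ⟩
  -- the three pieces
  have hA := D.isFenceOn_sectorFence h (j := j) hε hχ₀ hχ hβ₀ h0
  have hC := D.isFenceOn_sectorFence h (j := j') hε hχ₀ hχ h0 hβ₀
  have hT₁pl : ∀ τ ∈ Ioo (τ₀ - ε) (τ₀ + ε), D.gateT₁ h j χ τ ∈ plaque (D.box v) (D.gateIso h χ τ) := fun τ hτ ↦
    ⟨D.mapsTo_S h j (P.pt_mem (hrect τ hτ)), by
      show (D.box v (g (P.pt j (0, χ τ)))).2 = _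
      rw [gateIso_apply]; exact D.level_pt_eq_levelIso h j (hrect τ hτ)⟩
  have hT₂pl : ∀ τ ∈ Ioo (τ₀ - ε) (τ₀ + ε), D.gateT₂ h j' χ τ ∈ plaque (D.box v) (D.gateIso h χ τ) := fun τ hτ ↦
    ⟨D.mapsTo_S h j' (P.pt_mem (hrect τ hτ)), by
      show (D.box v (g (P.pt j' (0, χ τ)))).2 = _
      rw [gateIso_apply]; exact D.level_pt_eq_levelIso h j' (hrect τ hτ)⟩
  have hgcont : ∀ (k : ZMod (D.nprong v)), ContinuousOn (fun τ ↦ g (P.pt k (0, χ τ))) (Ioo (τ₀ - ε) (τ₀ + ε)) := by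
    intro k
    have hpt : ContinuousOn (fun τ ↦ P.pt k (0, χ τ)) (Ioo (τ₀ - ε) (τ₀ + ε)) :=
      (P.continuousOn_pt k).comp (continuous_const.prodMk χ.continuous).continuousOn fun τ hτ ↦ hrect τ hτ
    exact D.continuousOn.comp hpt fun τ hτ ↦ D.ball_subset v (D.mem_P v h) (D.mem_ball_of_mem_S h (P.pt_mem (hrect τ hτ)))
  have hMid : IsFenceOn T (slidePath hbox (isHomeoGermAt_orderIso (D.gateIso h χ).symm (D.gateIso h χ τ₀))
      (D.gateT₁ h j χ) (D.gateT₂ h j' χ)) τ₀ ε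
      (slideFence (D.box v) (D.gateIso h χ) (D.gateT₁ h j χ) (D.gateT₂ h j' χ)) univ :=
    IsFenceOn.slide hbox _ (D.gateIso h χ).continuous.continuousOn (D.gateIso h χ).injective.injOn
      (fun τ _ ↦ (D.gateIso h χ).symm_apply_apply τ) (Eventually.of_forall fun r ↦ (D.gateIso h χ).apply_symm_apply r)
      (hgcont j) (hgcont j') hT₁pl hT₂pl hε
  -- first concatenation
  have hj₁ : ∀ τ ∈ Ioo (τ₀ - ε) (τ₀ + ε), D.sectorFence h j β₀ 0 χ 1 τ =
      slideFence (D.box v) (D.gateIso h χ) (D.gateT₁ h j χ) (D.gateT₂ h j' χ) 0 τ := fun τ hτ ↦ by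
    rw [sectorFence_one, slideFence_zero (hT₁pl τ hτ)]; rfl
  have hε₂ : 0 < ε / 2 := by linarith
  have hMid' : IsFenceOn T ((slidePath hbox (isHomeoGermAt_orderIso (D.gateIso h χ).symm (D.gateIso h χ τ₀))
      (D.gateT₁ h j χ) (D.gateT₂ h j' χ)).cast (D.sectorGerm_one_eq_slideGerm_zero h (j := j) (j' := j') (β₀ := β₀) hχ₀)
        (D.slideGerm_one_eq_sectorGerm_zero h (j := j) (j' := j') (β₀ := β₀) hχ₀).symm) τ₀ ε
      (slideFence (D.box v) (D.gateIso h χ) (D.gateT₁ h j χ) (D.gateT₂ h j' χ)) univ := hMid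
  have hAM := IsFenceOn.trans hA hMid' hj₁ hε₂ (by linarith)
  -- second concatenation
  have hC' : IsFenceOn T (D.sectorPath h j' h0 hβ₀ χ τ₀) τ₀ (ε / 2) (D.sectorFence h j' 0 β₀ χ) univ :=
    hC.mono Subset.rfl (show ε / 2 ≤ ε by linarith)
  have hI₂ : Ioo (τ₀ - ε / 2) (τ₀ + ε / 2) ⊆ Ioo (τ₀ - ε) (τ₀ + ε) := Ioo_subset_Ioo (by linarith) (by linarith)
  have hj₂ : ∀ τ ∈ Ioo (τ₀ - ε / 2) (τ₀ + ε / 2),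
      transFence (D.sectorFence h j β₀ 0 χ) (slideFence (D.box v) (D.gateIso h χ) (D.gateT₁ h j χ) (D.gateT₂ h j' χ)) 1 τ =
        D.sectorFence h j' 0 β₀ χ 0 τ := fun τ hτ ↦ by
    rw [transFence_one, slideFence_one (hT₂pl τ (hI₂ hτ)), sectorFence_zero]; rfl
  exact IsFenceOn.trans hAM hC' hj₂ (by linarith) (by linarith)

/-- **The initial vertical of the gate fence** is the star vertical of the sector `j` at `β₀`:
`τ ↦ g (pt j (β₀, χ τ))`. [folklore] -/
theorem gateFence_zero (τ : ℝ) : D.gateFence h j j' β₀ χ 0 τ = g ((D.star v h).pt j (β₀, χ τ)) := by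
  rw [gateFence, transFence_zero, transFence_zero, sectorFence_zero]

/-- **The final vertical of the gate fence** is the star vertical of the sector `j'` at `β₀`:
`τ ↦ g (pt j' (β₀, χ τ))`. [folklore] -/
theorem gateFence_one (τ : ℝ) : D.gateFence h j j' β₀ χ 1 τ = g ((D.star v h).pt j' (β₀, χ τ)) := by
  rw [gateFence, transFence_one, sectorFence_one]

end Gate

end StarData

end Literature.Topology.PlanarFoliations
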